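import Summits.Ventures.PercRepro.C041TriDomExcessFour
import Summits.Ventures.PercRepro.C041TriDomExcessWeighted

/-!
# ROW C-041 — THE DELETION–CONTRACTION METHOD AT EVERY EDGE PROBABILITY, FOUR MARKS, I: the forced red pattern
(p6, gen 42; P6-TWOEXIT-LEAN.md §53 ADDENDUM 7)

THIS MODULE: the forced red adjacency at the status changes, the forced red four-point pattern `rsigF6`, the
refinement lemmas, the base case and the symmetry check; the weighted sum, THE WEIGHTED RECURSION and THE METHOD AT
EVERY EDGE PROBABILITY are in `C041TriDomExcessWeightedFour`.

The four-mark method of `C041TriDomExcessFour` (`sumF6_nonneg`: every admissible functional `F : P6 → P6 → ℤ` gives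
a theorem at `p = ½`) with forced-red edges and edge probabilities, as `C041TriDomExcessWeighted` /
`C041TriDomExcessWeightedMethod` do for three marks.  The forced red four-point pattern `rsigF6 R st ω` (the red
adjacency `RAdjF R st ω` of `C041TriDomExcessForced`), its status-change lemmas at the adjacency level
(`RAdjF_of_true`, `RAdjF_of_false`, `RAdjF_update_nonfree`, `RAdjF_forced_eq` — forcing `f` red is the contraction
of `f` for the red adjacency — and `RAdjF_false`), the refinement `le6_rsigF6`, the base case
`DCAdmissible6.nonneg_of_le6` (an admissible SYMMETRIC functional is non-negative on comparable pairs: THE KEY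
LEMMA with the same coarsening in both colours), and the weighted sum `sumFW6 F R st w = Σ_ω cwt w ω · F (rsigF6 R
st ω) (bsig6 st ω)` with **THE WEIGHTED RECURSION** `sumFW6_rec_ge` (the mixture of a forced-red and a fair edge)
and **THE METHOD AT EVERY EDGE PROBABILITY, FOUR MARKS** `sumFW6_nonneg` (`w e ∈ [½, 1]`), `sumFW6_free_nonneg`,
the complementation `sumFW6_free_cpl` and `sumFW6_free_nonneg_of_le_half` (`w e ∈ [0, ½]`).  The Boolean symmetry
check on the encodings `chksym6e` / `symm6_of_chke` serves the generated rays (`C041TriDomExcessWeightedFourRays`):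
every ray of the four-mark cone is a theorem at every edge probability on one side of `½`.
-/

namespace PercRepro

namespace ZoneZ

namespace MultiExit

open ZoneData Finset

variable {V₁ E₁ U₁ U₂ : Type} (Z₁ : ZoneData V₁ E₁ U₁ U₂) (u u' u'' a₁ : V₁)

/-! ## The forced red adjacency: status changes at the adjacency level -/

/-- Without forced edges the forced red adjacency is the red adjacency. -/
theorem RAdjF_false (st : E₁ → EStat) (ω : E₁ → Bool) : RAdjF Z₁ (fun _ => False) st ω = RAdjS Z₁ st ω := by
  funext x y
  simp [RAdjF, RAdjS]

variable [DecidableEq E₁]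

/-- Colouring a free edge red: the forced red adjacency is that of the contraction. -/
theorem RAdjF_of_true (R : E₁ → Prop) {st : E₁ → EStat} {f : E₁} (hf : st f = .free) {ω : E₁ → Bool}
    (hω : ω f = true) : RAdjF Z₁ R st ω = RAdjF Z₁ R (Function.update st f .double) ω := by
  refine RAdjF_congr Z₁ R fun e => ?_
  by_cases he : e = f
  · subst he; simp [redE, hf, hω]
  · simp [redE, Function.update_of_ne he]

/-- Colouring a free edge blue: the forced red adjacency is that of the deletion. -/
theorem RAdjF_of_false (R : E₁ → Prop) {st : E₁ → EStat} {f : E₁} (hf : st f = .free) {ω : E₁ → Bool}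
    (hω : ω f = false) : RAdjF Z₁ R st ω = RAdjF Z₁ R (Function.update st f .absent) ω := by
  refine RAdjF_congr Z₁ R fun e => ?_
  by_cases he : e = f
  · subst he; simp [redE, hf, hω]
  · simp [redE, Function.update_of_ne he]

/-- A non-free edge ignores its colour (forced red adjacency). -/
theorem RAdjF_update_nonfree (R : E₁ → Prop) (st : E₁ → EStat) (f : E₁) {s : EStat} (hs : s ≠ .free)
    (ω : E₁ → Bool) (b : Bool) :
    RAdjF Z₁ R (Function.update st f s) (Function.update ω f b) = RAdjF Z₁ R (Function.update st f s) ω := by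
  refine RAdjF_congr Z₁ R fun e => ?_
  by_cases he : e = f
  · subst he; simp [redE, hs]
  · simp [redE, Function.update_of_ne he]

/-- Forcing `f` red (deleting it from the status, adding it to the forced set) is the contraction of `f` for the
forced red adjacency. -/
theorem RAdjF_forced_eq (R : E₁ → Prop) (st : E₁ → EStat) (f : E₁) (ω : E₁ → Bool) :
    RAdjF Z₁ (fun e => R e ∨ e = f) (Function.update st f .absent) ω =
      RAdjF Z₁ R (Function.update st f .double) ω := by
  funext x y
  refine propext (exists_congr fun e => and_congr_right fun _ => ?_)
  by_cases he : e = f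
  · subst he; simp [redE]
  · simp [redE, he]

/-- Contracting an edge only enlarges the forced red adjacency of its deletion. -/
theorem RAdjF_absent_le_double (R : E₁ → Prop) (st : E₁ → EStat) (f : E₁) (ω : E₁ → Bool) (x y : V₁)
    (h : RAdjF Z₁ R (Function.update st f .absent) ω x y) : RAdjF Z₁ R (Function.update st f .double) ω x y := by
  obtain ⟨e, he, hr⟩ := h
  refine ⟨e, he, ?_⟩
  by_cases hef : e = f
  · subst hef; simp [redE]
  · simpa [redE, Function.update_of_ne hef] using hr

/-! ## The forced red four-point pattern -/

open Classical in
/-- The red four-point pattern with forced-red edges. -/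
noncomputable def rsigF6 (R : E₁ → Prop) (st : E₁ → EStat) (ω : E₁ → Bool) : P6 :=
  (decide (RdF Z₁ R st ω a₁ u), decide (RdF Z₁ R st ω a₁ u'), decide (RdF Z₁ R st ω a₁ u''),
    decide (RdF Z₁ R st ω u u'), decide (RdF Z₁ R st ω u u''), decide (RdF Z₁ R st ω u' u''))

omit [DecidableEq E₁] in
/-- The forced red pattern is a partition. -/
theorem trans6_rsigF6 (R : E₁ → Prop) (st : E₁ → EStat) (ω : E₁ → Bool) :
    Trans6 (rsigF6 Z₁ u u' u'' a₁ R st ω) := by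
  simp only [Trans6, rsigF6, decide_eq_true_eq, RdF]
  have hR := RAdjF_symm Z₁ R st ω
  obtain ⟨a1, a2, a3⟩ := tri_trans hR a₁ u u'
  obtain ⟨b1, b2, b3⟩ := tri_trans hR a₁ u u''
  obtain ⟨c1, c2, c3⟩ := tri_trans hR a₁ u' u''
  obtain ⟨d1, d2, d3⟩ := tri_trans hR u u' u''
  exact ⟨a1, a2, a3, b1, b2, b3, c1, c2, c3, d1, d2, d3⟩

omit [DecidableEq E₁] in
/-- Equal forced red adjacencies give equal patterns. -/
theorem rsigF6_congr (R R' : E₁ → Prop) {st st' : E₁ → EStat} {ω ω' : E₁ → Bool}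
    (h : RAdjF Z₁ R st ω = RAdjF Z₁ R' st' ω') : rsigF6 Z₁ u u' u'' a₁ R st ω = rsigF6 Z₁ u u' u'' a₁ R' st' ω' := by
  simp only [rsigF6, RdF, Prod.mk.injEq, decide_eq_decide, h, iff_self, and_self]

omit [DecidableEq E₁] in
/-- Without forced edges the forced red pattern is the red pattern. -/
theorem rsigF6_false (st : E₁ → EStat) (ω : E₁ → Bool) :
    rsigF6 Z₁ u u' u'' a₁ (fun _ => False) st ω = rsig6 Z₁ u u' u'' a₁ st ω := by
  simp only [rsigF6, rsig6, RdF, RdS, Prod.mk.injEq, decide_eq_decide, RAdjF_false, iff_self, and_self]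

/-- Contracting an edge only coarsens the forced red pattern of its deletion. -/
theorem le6_rsigF6 (R : E₁ → Prop) (st : E₁ → EStat) (f : E₁) (ω : E₁ → Bool) :
    Le6 (rsigF6 Z₁ u u' u'' a₁ R (Function.update st f .absent) ω)
      (rsigF6 Z₁ u u' u'' a₁ R (Function.update st f .double) ω) := by
  have h := RAdjF_absent_le_double Z₁ R st f ω
  simp only [Le6, rsigF6, RdF, decide_eq_true_eq]
  exact ⟨reach_mono h, reach_mono h, reach_mono h, reach_mono h, reach_mono h, reach_mono h⟩

omit [DecidableEq E₁] in
/-- Without free edges the blue pattern refines the forced red pattern. -/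
theorem le6_bsig6_rsigF6_of_nofree (R : E₁ → Prop) (st : E₁ → EStat) (hst : ∀ e, st e ≠ .free) (ω : E₁ → Bool) :
    Le6 (bsig6 Z₁ u u' u'' a₁ st ω) (rsigF6 Z₁ u u' u'' a₁ R st ω) := by
  have h : ∀ x y, BAdjS Z₁ st ω x y → RAdjF Z₁ R st ω x y := by
    intro x y ⟨e, he, hb⟩
    refine ⟨e, he, Or.inl ?_⟩
    rcases hb with hb | hb
    · exact Or.inl hb
    · exact absurd hb.1 (hst e)
  simp only [Le6, bsig6, rsigF6, MgS, RdF, decide_eq_true_eq]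
  exact ⟨reach_mono h, reach_mono h, reach_mono h, reach_mono h, reach_mono h, reach_mono h⟩

/-! ## The base case: admissible symmetric functionals on comparable pairs -/

/-- THE KEY LEMMA with the same coarsening in both colours: a symmetric admissible functional is non-negative on
comparable pairs. -/
theorem DCAdmissible6.nonneg_of_le6 {F : P6 → P6 → ℤ} (hF : DCAdmissible6 F)
    (hsym : ∀ s t, Trans6 s → Trans6 t → F s t = F t s) {s t : P6} (hs : Trans6 s) (ht : Trans6 t)
    (hle : Le6 t s) : 0 ≤ F s t := by
  have h := hF.key t s t s ⟨ht, hs, ht, hs, hle, hle⟩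
  rw [hF.diag t ht, hF.diag s hs, hsym t s ht hs] at h
  linarith

/-- The Boolean symmetry check of a functional on the ENCODINGS over the partitions. -/
def chksym6e (Fe : ℕ → ℕ → ℤ) : Bool :=
  valid6e.all fun a => valid6e.all fun b => decide (Fe a b = Fe b a)

/-- A functional on the encodings passing the symmetry check is symmetric on the patterns. -/
theorem symm6_of_chke (Fe : ℕ → ℕ → ℤ) (h : chksym6e Fe = true) :
    ∀ s t : P6, Trans6 s → Trans6 t → Fe (enc6 s) (enc6 t) = Fe (enc6 t) (enc6 s) := by
  unfold chksym6e at h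
  simp only [List.all_eq_true, decide_eq_true_eq] at h
  intro s t hs ht
  exact h _ (List.mem_map_of_mem (trans6_mem s hs)) _ (List.mem_map_of_mem (trans6_mem t ht))

end MultiExit

end ZoneZ

end PercRepro
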